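import Mathlib
import HarnessLib
import Literature.MathematicalPhysics.StatisticalMechanics.PolymerFactorisationBound
import Literature.MathematicalPhysics.StatisticalMechanics.PolymerProductBound

/-!
# Differences of factorising activities: `|K(X) − K'(X)|_{T,w^X} ≤ ∏_{Y∈𝒞(X)}(c_Y + ρ_Y) − ∏_Y c_Y`
# ([ABKM19] Lemma 8.3 (i) applied to `K − K'`, derivative of `P₃`)

For activities `K, K'` factorising over `(s+1)`-separated unions (`K(∅) = K'(∅) = 1`) the difference
`K(X) − K'(X)` does NOT factorise, but it expands over the connected components:
`∏_Y K(Y) − ∏_Y K'(Y) = Σ_{∅ ≠ 𝒮 ⊆ 𝒞(X)} ∏_{Y∈𝒮}(K − K')(Y) ∏_{Y∉𝒮} K'(Y)`, whence with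
`|K'(Y)|_{T_Y,w^Y} ≤ c_Y`, `|K(Y) − K'(Y)|_{T_Y,w^Y} ≤ ρ_Y` and the weight factorisation (w3):
`|K(X) − K'(X)|_{T, w^X} ≤ ∏_{Y ∈ 𝒞(X)} (c_Y + ρ_Y) − ∏_Y c_Y`.  (In [ABKM19] this is the derivative
`D_K(∏_{Y∈𝒞(X)} K(Y))(K̇)` of the map `P₃`, Lemma 9.5 (9.26).)

* `tayNormLE_prod_sub_prod` — the abstract finite-product version;
* **`tayNormLE_factorises_sub`** — for two factorising activities on an `s`-polymer `X`.

Everything is proved; no named fact.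

## References
* S. Adams, S. Buchholz, R. Kotecký, S. Müller, arXiv:1910.13564, Lemma 8.3 (i), Lemma 9.5 (9.26)
  [AdamsBuchholzKoteckyMuller2019].
-/

noncomputable section

namespace Literature.MathematicalPhysics.StatisticalMechanics.GradientRG

open scoped BigOperators Classical
open Finset
open Literature.MathematicalPhysics.StatisticalMechanics.TorusPolymer (IsPolymer Separated)
open Literature.Barriers.CriticalPhenomena.LongRangePhi4.Polymer (IsConn components)
open Literature.MathematicalPhysics.QuantumFieldTheory

variable {d M : ℕ} [NeZero M]
  {V : Type*} [NormedAddCommGroup V] [NormedSpace ℝ V]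

/-- **Difference of finite products**: `|∏_i K_i − ∏_i K'_i|_{T,w} ≤ ∏_i (c_i + ρ_i) − ∏_i c_i` for
`T_i`-local `C^{r₀}` factors with `|K'_i|_{T_i,w_i} ≤ c_i`, `|K_i − K'_i|_{T_i,w_i} ≤ ρ_i` (`c, ρ ≥ 0`),
gauges `T_i ≤ T` and `∏_i w_i ≤ w`. [cite: AdamsBuchholzKoteckyMuller2019, Lemma 9.5 (9.26)] -/
theorem tayNormLE_prod_sub_prod {ι : Type*} {T : ((Fin d → ZMod M) → ℝ) →ₗ[ℝ] V} {r₀ : ℕ}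
    {w : ((Fin d → ZMod M) → ℝ) → ℝ}
    {Vi : ι → Type*} [∀ i, NormedAddCommGroup (Vi i)] [∀ i, NormedSpace ℝ (Vi i)]
    {Ti : ∀ i, ((Fin d → ZMod M) → ℝ) →ₗ[ℝ] Vi i} {wi : ι → ((Fin d → ZMod M) → ℝ) → ℝ}
    {Ki Ki' : ι → ((Fin d → ZMod M) → ℝ) → ℂ} {c ρ : ι → ℝ} (S : Finset ι)
    (hK' : ∀ i ∈ S, TayNormLE (Ti i) r₀ (wi i) (Ki' i) (c i))
    (hΔ : ∀ i ∈ S, TayNormLE (Ti i) r₀ (wi i) (fun φ => Ki i φ - Ki' i φ) (ρ i))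
    (hle : ∀ i ∈ S, ∀ ξ, ‖Ti i ξ‖ ≤ ‖T ξ‖)
    (hKd : ∀ i ∈ S, ContDiff ℝ r₀ (Ki i)) (hK'd : ∀ i ∈ S, ContDiff ℝ r₀ (Ki' i))
    (hKloc : ∀ i ∈ S, IsGaugeLocal (Ti i) (Ki i)) (hK'loc : ∀ i ∈ S, IsGaugeLocal (Ti i) (Ki' i))
    (hc : ∀ i ∈ S, 0 ≤ c i) (hρ : ∀ i ∈ S, 0 ≤ ρ i)
    (hw : ∀ φ, ∏ i ∈ S, wi i φ ≤ w φ) :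
    TayNormLE T r₀ w (fun φ => ∏ i ∈ S, Ki i φ - ∏ i ∈ S, Ki' i φ)
      ((∏ i ∈ S, (c i + ρ i)) - ∏ i ∈ S, c i) := by
  -- binomial expansion `∏ K = ∏ ((K − K') + K') = Σ_𝒮 ∏_𝒮 (K−K') ∏_{𝒮ᶜ} K'`
  have hfun : (fun φ => ∏ i ∈ S, Ki i φ - ∏ i ∈ S, Ki' i φ) = fun φ =>
      ∑ 𝒮 ∈ S.powerset.erase ∅, (∏ i ∈ 𝒮, (Ki i φ - Ki' i φ)) * ∏ i ∈ S \ 𝒮, Ki' i φ := by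
    funext φ
    have h := Finset.prod_add (fun i => Ki i φ - Ki' i φ) (fun i => Ki' i φ) S
    simp only [sub_add_cancel] at h
    rw [h, ← Finset.add_sum_erase _ _ (Finset.empty_mem_powerset S)]
    simp
  have hconst : (∏ i ∈ S, (c i + ρ i)) - ∏ i ∈ S, c i =
      ∑ 𝒮 ∈ S.powerset.erase ∅, (∏ i ∈ 𝒮, ρ i) * ∏ i ∈ S \ 𝒮, c i := by
    have h := Finset.prod_add (fun i => ρ i) (fun i => c i) S
    rw [← Finset.add_sum_erase _ _ (Finset.empty_mem_powerset S)] at h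
    simp only [Finset.prod_empty, Finset.sdiff_empty, one_mul] at h
    have h' : ∏ i ∈ S, (c i + ρ i) = ∏ i ∈ S, (ρ i + c i) := Finset.prod_congr rfl fun i _ => add_comm _ _
    rw [h', h]
    ring
  rw [hfun, hconst]
  have hΔd : ∀ i ∈ S, ContDiff ℝ r₀ (fun φ => Ki i φ - Ki' i φ) := fun i hi => (hKd i hi).sub (hK'd i hi)
  have hΔloc : ∀ i ∈ S, IsGaugeLocal (Ti i) (fun φ => Ki i φ - Ki' i φ) := fun i hi φ ψ h => by
    show Ki i φ - Ki' i φ = Ki i ψ - Ki' i ψ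
    rw [hKloc i hi φ ψ h, hK'loc i hi φ ψ h]
  refine TayNormLE.sum (T := T) (r₀ := r₀) (S.powerset.erase ∅) (fun 𝒮 h𝒮 => ?_) (fun 𝒮 h𝒮 => ?_)
  · have h𝒮S : 𝒮 ⊆ S := Finset.mem_powerset.1 (Finset.mem_of_mem_erase h𝒮)
    have hdS : S \ 𝒮 ⊆ S := sdiff_subset
    have h1 := TayNormLE.prod (T := T) (r₀ := r₀) (w := fun φ => ∏ i ∈ 𝒮, wi i φ) (Ti := fun i => Ti i)
      (wi := fun i => wi i) (Ki := fun i => fun φ => Ki i φ - Ki' i φ) (Ci := ρ) 𝒮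
      (fun i hi => hΔ i (h𝒮S hi)) (fun i hi => hle i (h𝒮S hi)) (fun i hi => hΔd i (h𝒮S hi))
      (fun i hi => hΔloc i (h𝒮S hi)) (fun i hi => hρ i (h𝒮S hi)) (fun φ => le_rfl)
    have h2 := TayNormLE.prod (T := T) (r₀ := r₀) (w := fun φ => ∏ i ∈ S \ 𝒮, wi i φ) (Ti := fun i => Ti i)
      (wi := fun i => wi i) (Ki := fun i => Ki' i) (Ci := c) (S \ 𝒮)
      (fun i hi => hK' i (hdS hi)) (fun i hi => hle i (hdS hi)) (fun i hi => hK'd i (hdS hi))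
      (fun i hi => hK'loc i (hdS hi)) (fun i hi => hc i (hdS hi)) (fun φ => le_rfl)
    refine TayNormLE.mul (T := T) (w := w) h1 h2 (fun ξ => le_rfl) (fun ξ => le_rfl)
      (contDiff_prod fun i hi => hΔd i (h𝒮S hi)) (contDiff_prod fun i hi => hK'd i (hdS hi))
      (IsGaugeLocal.prod _ fun i hi => (hΔloc i (h𝒮S hi)).of_norm_le (hle i (h𝒮S hi)))
      (IsGaugeLocal.prod _ fun i hi => (hK'loc i (hdS hi)).of_norm_le (hle i (hdS hi)))
      (Finset.prod_nonneg fun i hi => hρ i (h𝒮S hi)) (Finset.prod_nonneg fun i hi => hc i (hdS hi))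
      (fun φ => ?_)
    rw [← Finset.prod_union (disjoint_sdiff), Finset.union_sdiff_of_subset h𝒮S]
    exact hw φ
  · have h𝒮S : 𝒮 ⊆ S := Finset.mem_powerset.1 (Finset.mem_of_mem_erase h𝒮)
    exact (contDiff_prod fun i hi => hΔd i (h𝒮S hi)).mul (contDiff_prod fun i hi => hK'd i (sdiff_subset hi))

/-- **Difference of two factorising activities** ([ABKM19] Lemma 8.3 (i) for `K − K'`): on an odd torus
`M = s·t`, for activities `K, K'` factorising on scale `s` with `K(∅) = K'(∅) = 1`, weights
factorising over `(s+1)`-separated polymers (`w(∅) = 1`), component gauges `T_Y ≤ T`, and bounds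
`|K'(Y)|_{T_Y,w^Y} ≤ c_Y`, `|K(Y) − K'(Y)|_{T_Y,w^Y} ≤ ρ_Y` on the components of the `s`-polymer `X`:
`|K(X) − K'(X)|_{T, w^X} ≤ ∏_{Y ∈ 𝒞(X)}(c_Y + ρ_Y) − ∏_Y c_Y`.
[cite: AdamsBuchholzKoteckyMuller2019, Lemma 9.5 (9.26)] -/
theorem tayNormLE_factorises_sub {s t : ℕ} (hM : M = s * t) (hs : Odd s) (ht : Odd t)
    (T : ((Fin d → ZMod M) → ℝ) →ₗ[ℝ] V)
    {Vp : Finset (Fin d → ZMod M) → Type*} [∀ Y, NormedAddCommGroup (Vp Y)] [∀ Y, NormedSpace ℝ (Vp Y)]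
    (Tp : ∀ Y : Finset (Fin d → ZMod M), ((Fin d → ZMod M) → ℝ) →ₗ[ℝ] Vp Y) {r₀ : ℕ}
    {w : Finset (Fin d → ZMod M) → ((Fin d → ZMod M) → ℝ) → ℝ}
    (hw : ∀ X Y, IsPolymer s X → IsPolymer s Y → Separated (s + 1) X Y → ∀ φ, w (X ∪ Y) φ = w X φ * w Y φ)
    (hw0 : ∀ φ, w ∅ φ = 1)
    {K K' : Finset (Fin d → ZMod M) → ((Fin d → ZMod M) → ℝ) → ℂ} (hK : Factorises s K) (hK0 : ∀ φ, K ∅ φ = 1)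
    (hK' : Factorises s K') (hK'0 : ∀ φ, K' ∅ φ = 1)
    {X : Finset (Fin d → ZMod M)} (hX : IsPolymer s X) {c ρ : Finset (Fin d → ZMod M) → ℝ}
    (hb : ∀ Y ∈ components X, TayNormLE (Tp Y) r₀ (w Y) (K' Y) (c Y))
    (hbΔ : ∀ Y ∈ components X, TayNormLE (Tp Y) r₀ (w Y) (fun φ => K Y φ - K' Y φ) (ρ Y))
    (hle : ∀ Y ∈ components X, ∀ ξ, ‖Tp Y ξ‖ ≤ ‖T ξ‖)
    (hKd : ∀ Y ∈ components X, ContDiff ℝ r₀ (K Y)) (hK'd : ∀ Y ∈ components X, ContDiff ℝ r₀ (K' Y))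
    (hKloc : ∀ Y ∈ components X, IsGaugeLocal (Tp Y) (K Y))
    (hK'loc : ∀ Y ∈ components X, IsGaugeLocal (Tp Y) (K' Y))
    (hc : ∀ Y ∈ components X, 0 ≤ c Y) (hρ : ∀ Y ∈ components X, 0 ≤ ρ Y) :
    TayNormLE T r₀ (w X) (fun φ => K X φ - K' X φ)
      ((∏ Y ∈ components X, (c Y + ρ Y)) - ∏ Y ∈ components X, c Y) := by
  have hMo : Odd M := by rw [hM]; exact hs.mul ht
  have hpoly : ∀ Y ∈ components X, IsPolymer s Y := fun Y hY =>
    (TorusPolymer.IsPolymer.of_mem_components hMo hs hX hY).1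
  have hsep := TorusPolymer.pairwise_separated_components hM hs ht hX
  have hXeq : X = (components X).biUnion id :=
    Literature.Barriers.CriticalPhenomena.LongRangePhi4.Polymer.eq_biUnion_components X
  have hKX : ∀ φ, K X φ = ∏ Y ∈ components X, K Y φ := fun φ => by
    conv_lhs => rw [hXeq]; exact eq_prod_of_factorises hK hK0 _ hpoly hsep φ
  have hK'X : ∀ φ, K' X φ = ∏ Y ∈ components X, K' Y φ := fun φ => by
    conv_lhs => rw [hXeq]; exact eq_prod_of_factorises hK' hK'0 _ hpoly hsep φ
  have hwX : ∀ φ, ∏ Y ∈ components X, w Y φ ≤ w X φ := fun φ => by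
    conv_rhs => rw [hXeq]
    rw [eq_prod_weight hw hw0 _ hpoly hsep φ]
  have hfun : (fun φ => K X φ - K' X φ) = fun φ => ∏ Y ∈ components X, K Y φ - ∏ Y ∈ components X, K' Y φ := by
    funext φ; rw [hKX, hK'X]
  rw [hfun]
  exact tayNormLE_prod_sub_prod (T := T) (Ti := fun Y => Tp Y) (wi := fun Y => w Y) (Ki := fun Y => K Y)
    (Ki' := fun Y => K' Y) (components X) hb hbΔ hle hKd hK'd hKloc hK'loc hc hρ hwX

end Literature.MathematicalPhysics.StatisticalMechanics.GradientRG

end
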